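import Summits.QuantumAdvantage.QuantumAdvantage.Theorems.CodimDialHost
import Literature.Computability.Complexity.MCSPHardnessKabanetsCaiProofs

/-!
# CodimDial — part 5/6 «Medium» (cell decomp-qadv, seat lens-5, generation 12 rev 2; supports item 30910 `SpreadDial.PureCover3`)

§10 THE MEDIUM REGIME: `LinSpreadLogMed3` (log codimension, rows of weight `≤ n/4`), pieces **A = `LinCoverLogMed3`**, **B = `MedBridge3`**, aside `WeightLift3`; `hostQ` and ★ REALISATION `linSpreadLogMed3_of_spreadLoss3` (every medium system IS the joint win event of `O(log n)` host rings, all `n ≥ 4`); `algSpread3_of_linSpreadLogMed3`; ★ EXACT CONJUNCT SPLIT `pureCover3_iff_medPieces : SpreadDial.PureCover3 ↔ (LinCoverLogMed3 ∧ MedBridge3)`, `coverLift3_iff_medPieces`, `closes₄` (leaf BY NAME), necessity `linCoverLogMed3_of_ringHardOdd`, `medBridge3_of_ringHardOdd`.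

Verbatim from the node file `run/shared/lean/pub/decomp-qadv/decomp-qadv-lens-5/g12/CodimDial.lean` (rev 2, sha256 b503e7e59b532c38…;
record `…/g12/NODE-g12.md`; critic row 74 VERIFIED/CLEARED the split), re-namespaced `…Theses.CodimDial` ↦ `…Theorems.CodimDial`;
imports part 4/6 (`CodimDialHost`); joint check of parts 1–5 = `g12/tree/Parts1to5.check.lean` (farm rc 0 · 0 errors ·
0 warnings · 0 sorries).  The `def … : Prop` declarations are STATEMENTS OF THE NODE (regimes of the dial and the two pieces of the exact split
`PureCover3 ⟺ A ∧ B`), not new cruxes; the pieces to FILE are `FewCover3` / `FewBridge3` (part 6) or equivalently `LinCoverLogMed3` / `MedBridge3` (part 5).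
NODE EQUATION: `AdviceFreeQNC0Three ⟸ PolyLoss3 [26123] ∧ AlgCover3 [30909] ∧ A ∧ B`, `PureCover3 (30910) ⟺ A ∧ B` (kernel).
-/

set_option linter.style.longLine false
set_option linter.dupNamespace false

noncomputable section
open scoped Classical

namespace Summit.QuantumAdvantage.QuantumAdvantage.Theorems.CodimDial

open Finset
open Literature.Computability.QuantumComplexity Literature.Computability.QuantumComplexity.RingHLF
open Literature.Computability.MetaComplexity
open Summit.QuantumAdvantage.AdviceFreeQNC0
open Summit.QuantumAdvantage.QuantumAdvantage.Theses

/-! ## §10  THE MEDIUM REGIME: rows of weight `≤ n/4` — the regime the ring currency (29064) can see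

`LinSpreadLogMed3` = the dial at logarithmic codimension restricted to rows of weight `≤ n/4`.  Every such system
IS the joint win event of `ℓ = O(log n)` host rings (§9), so `SpreadLoss3 (29064) ⟹ LinSpreadLogMed3` and
`PureCover3 (30910) ⟹ LinCoverLogMed3`; conversely the medium dial gives back one algebraic test
(`AlgSpread3`), whence the EXACT CONJUNCT SPLIT `PureCover3 ⟺ LinCoverLogMed3 ∧ MedBridge3`. -/

section Medium
variable {n : ℕ}

/-- at logarithmic codimension the number of rows is `≤ n` (once `log₂ n ≥ 4C + 4`). [arithmetic] -/
theorem rows_le_self {C ℓ : ℕ} (hL : 4 * C + 4 ≤ Nat.log 2 n) (hℓ : 2 ^ ℓ ≤ n ^ C) : ℓ ≤ n := by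
  set L := Nat.log 2 n with hLdef
  have h1 : n < 2 ^ (L + 1) := Nat.lt_pow_succ_log_self (by norm_num) n
  have hℓL : ℓ ≤ C * (L + 1) := by
    have : 2 ^ ℓ ≤ 2 ^ (C * (L + 1)) :=
      calc 2 ^ ℓ ≤ n ^ C := hℓ
        _ ≤ (2 ^ (L + 1)) ^ C := Nat.pow_le_pow_left h1.le C
        _ = 2 ^ (C * (L + 1)) := by rw [← pow_mul, mul_comm]
    exact (Nat.pow_le_pow_iff_right (by norm_num)).mp this
  have hn0 : n ≠ 0 := by
    intro h0; rw [h0, Nat.log_zero_right] at hLdef; omega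
  calc ℓ ≤ C * (L + 1) := hℓL
    _ ≤ L * L := by nlinarith
    _ ≤ 2 ^ L := Literature.Computability.Complexity.KabanetsCai.sq_le_two_pow (by omega)
    _ ≤ n := Nat.pow_log_le_self 2 hn0

/-- the odd slot `2j+1`. -/
def slot (n W : ℕ) (hW : 2 * W + 1 < n) (j : Fin (W + 1)) : Fin n := ⟨2 * j.val + 1, by have := j.isLt; omega⟩

/-- CodimDialMediumA helper `slot_injective` (decomp-qadv land package; see the module docstring). -/
theorem slot_injective (W : ℕ) (hW : 2 * W + 1 < n) : Function.Injective (slot n W hW) := by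
  intro j j' h
  have := congrArg Fin.val h
  simp only [slot] at this
  exact Fin.ext (by omega)

/-- the adjuster bit `β + n` and the constant output carrying it. -/
def adjBit (n : ℕ) (β : ZMod 2) : ZMod 2 := β + (n : ZMod 2)

/-- CodimDialMediumA helper `adjFn` (decomp-qadv land package; see the module docstring). -/
def adjFn (n : ℕ) (β : ZMod 2) : Smolensky.CubeFn (ZMod 3) n := if adjBit n β = 0 then 0 else 1

/-- CodimDialMediumA helper `bit_adjFn` (decomp-qadv land package; see the module docstring). -/
theorem bit_adjFn (β : ZMod 2) (y : Fin n → Bool) : bit (adjFn n β) y = adjBit n β := by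
  unfold adjFn
  rcases (by decide : ∀ t : ZMod 2, t = 0 ∨ t = 1) (adjBit n β) with h | h
  · rw [h, if_pos rfl]; simp [bit]
  · rw [h, if_neg one_ne_zero]; simp [bit]

/-- CodimDialMediumA helper `adjFn_mem_lowDeg` (decomp-qadv land package; see the module docstring). -/
theorem adjFn_mem_lowDeg (β : ZMod 2) (D : ℕ) : adjFn n β ∈ Smolensky.lowDeg (ZMod 3) n D := by
  unfold adjFn
  split_ifs
  · exact Submodule.zero_mem _
  · exact Smolensky.one_mem_lowDeg _

/-- the values carried by the `W+1` odd slots of the host of row `a`: the support bits (in some order), then the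
adjuster. -/
def slotVal {N : ℕ} (G : Fin N → Smolensky.CubeFn (ZMod 3) n) (a : Fin N → ZMod 2) (β : ZMod 2)
    (j : Fin ((rowSupp a).card + 1)) : Smolensky.CubeFn (ZMod 3) n :=
  if h : j.val < (rowSupp a).card then G ((rowSupp a).equivFin.symm ⟨j.val, h⟩) else adjFn n β

/-- **the host ring's outputs** for row `a`, right-hand side `β`: support bits and adjuster on the odd slots
`1, 3, …, 2W+1`, the constant `0` everywhere else. -/
def hostQ {N : ℕ} (G : Fin N → Smolensky.CubeFn (ZMod 3) n) (a : Fin N → ZMod 2) (β : ZMod 2) :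
    Fin n → Smolensky.CubeFn (ZMod 3) n :=
  fun s => if h : s.val % 2 = 1 ∧ s.val / 2 < (rowSupp a).card + 1 then slotVal G a β ⟨s.val / 2, h.2⟩ else 0

/-- CodimDialMediumA helper `hostQ_mem_lowDeg` (decomp-qadv land package; see the module docstring). -/
theorem hostQ_mem_lowDeg {N D : ℕ} (G : Fin N → Smolensky.CubeFn (ZMod 3) n)
    (hG : ∀ u, G u ∈ Smolensky.lowDeg (ZMod 3) n D) (a : Fin N → ZMod 2) (β : ZMod 2) (s : Fin n) :
    hostQ G a β s ∈ Smolensky.lowDeg (ZMod 3) n D := by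
  unfold hostQ slotVal
  split_ifs
  · exact hG _
  · exact adjFn_mem_lowDeg β D
  · exact Submodule.zero_mem _

/-- CodimDialMediumA helper `hostQ_even` (decomp-qadv land package; see the module docstring). -/
theorem hostQ_even {N : ℕ} (G : Fin N → Smolensky.CubeFn (ZMod 3) n) (a : Fin N → ZMod 2) (β : ZMod 2)
    {s : Fin n} (hs : s.val % 2 = 0) : hostQ G a β s = 0 := by
  unfold hostQ
  rw [dif_neg]
  omega

/-- the bit sum of the host: support parity plus adjuster. -/
theorem sum_bit_hostQ {N : ℕ} (G : Fin N → Smolensky.CubeFn (ZMod 3) n) (a : Fin N → ZMod 2) (β : ZMod 2)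
    (hW : 2 * (rowSupp a).card + 1 < n) (y : Fin n → Bool) :
    (∑ s : Fin n, bit (hostQ G a β s) y) = (∑ u ∈ rowSupp a, bit (G u) y) + adjBit n β := by
  let emb : Fin ((rowSupp a).card + 1) ↪ Fin n := ⟨slot n (rowSupp a).card hW, slot_injective _ hW⟩
  have himg : ∀ s ∈ (univ : Finset (Fin n)), s ∉ (univ : Finset (Fin ((rowSupp a).card + 1))).map emb →
      bit (hostQ G a β s) y = 0 := by
    intro s _ hs
    have h0 : hostQ G a β s = 0 := by
      unfold hostQ
      rw [dif_neg]
      rintro ⟨h1, h2⟩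
      apply hs
      rw [Finset.mem_map]
      refine ⟨⟨s.val / 2, h2⟩, Finset.mem_univ _, Fin.ext ?_⟩
      show 2 * (s.val / 2) + 1 = s.val
      omega
    rw [h0]; simp [bit]
  rw [← Finset.sum_subset (Finset.subset_univ _) himg, Finset.sum_map]
  have hslot : ∀ j : Fin ((rowSupp a).card + 1), hostQ G a β (emb j) = slotVal G a β j := by
    intro j
    have h1 : (slot n (rowSupp a).card hW j).val % 2 = 1 := by simp only [slot]; omega
    have h2 : (slot n (rowSupp a).card hW j).val / 2 = j.val := by simp only [slot]; omega
    show hostQ G a β (slot n (rowSupp a).card hW j) = slotVal G a β j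
    unfold hostQ
    rw [dif_pos ⟨h1, by rw [h2]; exact j.isLt⟩]
    congr 1
    exact Fin.ext h2
  simp only [hslot]
  rw [Fin.sum_univ_castSucc]
  congr 1
  · have hcs : ∀ j : Fin (rowSupp a).card, slotVal G a β j.castSucc = G ((rowSupp a).equivFin.symm j) := by
      intro j
      unfold slotVal
      rw [dif_pos (by exact j.isLt)]
      have hj : (⟨(j.castSucc : Fin ((rowSupp a).card + 1)).val, j.isLt⟩ : Fin (rowSupp a).card) = j := Fin.ext rfl
      rw [hj]
    simp only [hcs]
    rw [← Finset.sum_coe_sort (rowSupp a)]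
    exact (rowSupp a).equivFin.symm.sum_comp (fun x => bit (G x) y)
  · unfold slotVal
    rw [dif_neg (by simp)]
    exact bit_adjFn β y

/-- **the host ring wins iff the row constraint holds.** -/
theorem host_rel_iff {N : ℕ} (hn : 3 ≤ n) (G : Fin N → Smolensky.CubeFn (ZMod 3) n) (a : Fin N → ZMod 2)
    (β : ZMod 2) (hW : 2 * (rowSupp a).card + 1 < n) (y : Fin n → Bool) :
    RingHLF.Rel (zeroIn n) (fun s => decide (hostQ G a β s y = 1)) ↔ defect G a β y = 0 := by
  have hz : ∀ s : Fin n, s.val % 2 = 0 → decide (hostQ G a β s y = 1) = false := by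
    intro s hs
    rw [hostQ_even G a β hs]
    simp
  rw [rel_zeroIn_iff hn hz]
  have hcount : ((univ.filter fun s : Fin n => oddSl n s = true ∧ decide (hostQ G a β s y = 1) = true).card
      : ZMod 2) = defect G a β y + (n : ZMod 2) := by
    have hflt : (univ.filter fun s : Fin n => oddSl n s = true ∧ decide (hostQ G a β s y = 1) = true) =
        univ.filter fun s : Fin n => hostQ G a β s y = 1 := by
      ext s
      simp only [Finset.mem_filter, Finset.mem_univ, true_and, oddSl, decide_eq_true_eq]
      constructor
      · exact fun h => h.2
      · intro h
        refine ⟨?_, h⟩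
        by_contra hs
        have h0 := hostQ_even G a β (s := s) (by omega)
        rw [h0] at h
        exact absurd h (by simp)
    rw [hflt, Finset.natCast_card_filter]
    show (∑ s : Fin n, bit (hostQ G a β s) y) = _
    rw [sum_bit_hostQ G a β hW, defect_eq_sum_supp, adjBit]
    ring
  unfold dot2
  rw [← ZMod.natCast_eq_natCast_iff', hcount]
  constructor
  · intro h
    have := congrArg (· - (n : ZMod 2)) h
    simpa using this
  · intro h
    rw [h, zero_add]


end Medium
end Summit.QuantumAdvantage.QuantumAdvantage.Theorems.CodimDial
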